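/-
Copyright (c) 2026. All rights reserved.
Released under Apache 2.0 license as described in the file LICENSE.
-/
import Summits.Parity.BatemanHorn.Theorems.SoloInformedProperPrimePowers

/-!
# From the `ψ`-form to Hardy–Littlewood's Conjecture E (classical glue, kernel version)

`SoloInformedThreeRangeSchema` reduces `∑_{n ≤ x} Λ(n²+1) ~ 𝔖 x`
(`𝔖 = hardyLittlewoodEConst`) to the range hypotheses `(R1)`, `(R2)_ε`, `(R3)_ε`, and
`SoloInformedProperPrimePowers` shows that the proper prime powers among the `n² + 1` weigh
`o(x)`.  This file supplies the last classical step to the tree's statement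
`HardyLittlewoodConjE` (`#{n ≤ x : n²+1 prime} ~ (𝔖/2) x / log x`): `θ ~ 𝔖 x`, then
partial summation in its cheapest form (every prime value weighs
`≤ log(x²+1) ≤ 2 log x + 1`, every prime value with `n > x^{1-η}` weighs `≥ 2(1-η) log x`,
`η = c/8`).

Main results: `hardyLittlewoodConjE_of_isEquivalent_sum_vonMangoldt` and the composite
`hardyLittlewoodConjE_of_threeRanges : (R1) → (R2)_ε → (R3)_ε → HardyLittlewoodConjE` —
the complete kernel path from the three range statements to the conjecture as stated in the tree.
-/

namespace Summit.Parity.BatemanHorn.Theorems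

open Finset Filter ArithmeticFunction Asymptotics
open scoped ArithmeticFunction.Moebius Topology
open Literature.NumberTheory.Sieve (hardyLittlewoodEConst hardyLittlewoodEConst_pos
  nSqAddOnePrimeCount HardyLittlewoodConjE hardyLittlewoodConjE_iff_isEquivalent)
open Literature.NumberTheory.Sieve.Iwaniec1978 (rho rem)

/-! ### The two fixed-`x` inequalities of the partial summation, and their bookkeeping -/

/-- Lower-bound side: `θ ≤ π · log(x²+1)`. -/
theorem theta_le_card_mul_log (x : ℕ) :
    ∑ n ∈ (Icc 1 x).filter (fun n : ℕ => Nat.Prime (n ^ 2 + 1)),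
        Real.log ((n ^ 2 + 1 : ℕ) : ℝ)
      ≤ (nSqAddOnePrimeCount x : ℝ) * Real.log ((x : ℝ) ^ 2 + 1) := by
  unfold nSqAddOnePrimeCount
  rw [← nsmul_eq_mul]
  refine sum_le_card_nsmul _ _ _ fun n hn => ?_
  have hn' : n ≤ x := (mem_Icc.mp (mem_filter.mp hn).1).2
  have hnR : (n : ℝ) ≤ x := by exact_mod_cast hn'
  push_cast
  exact Real.log_le_log (by positivity) (by nlinarith)

/-- Upper-bound side: beyond `y`, every prime value `n² + 1` weighs `≥ 2 log (y+1)`; stated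
with any `0 ≤ L ≤ 2 log (y+1)` so that no sign condition on `π(x) - y` is needed. -/
theorem card_sub_mul_le_theta (x y : ℕ) {L : ℝ} (hL0 : 0 ≤ L)
    (hL : L ≤ 2 * Real.log ((y : ℝ) + 1)) :
    ((nSqAddOnePrimeCount x : ℝ) - y) * L
      ≤ ∑ n ∈ (Icc 1 x).filter (fun n : ℕ => Nat.Prime (n ^ 2 + 1)),
          Real.log ((n ^ 2 + 1 : ℕ) : ℝ) := by
  have hT0 : 0 ≤ ∑ n ∈ (Icc 1 x).filter (fun n : ℕ => Nat.Prime (n ^ 2 + 1)),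
      Real.log ((n ^ 2 + 1 : ℕ) : ℝ) := sum_nonneg fun n _ => Real.log_natCast_nonneg _
  have h : nSqAddOnePrimeCount x
      ≤ y + #((Icc (y + 1) x).filter fun n : ℕ => Nat.Prime (n ^ 2 + 1)) := by
    unfold nSqAddOnePrimeCount
    calc #((Icc 1 x).filter fun n : ℕ => Nat.Prime (n ^ 2 + 1))
        ≤ #(Icc 1 y ∪ (Icc (y + 1) x).filter fun n : ℕ => Nat.Prime (n ^ 2 + 1)) := by
          refine card_le_card fun n hn => ?_
          rw [mem_filter, mem_Icc] at hn
          rw [mem_union, mem_Icc, mem_filter, mem_Icc]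
          by_cases h : n ≤ y
          · exact Or.inl ⟨hn.1.1, h⟩
          · exact Or.inr ⟨⟨by omega, hn.1.2⟩, hn.2⟩
      _ ≤ #(Icc 1 y) + #((Icc (y + 1) x).filter fun n : ℕ => Nat.Prime (n ^ 2 + 1)) :=
          card_union_le _ _
      _ = y + #((Icc (y + 1) x).filter fun n : ℕ => Nat.Prime (n ^ 2 + 1)) := by
          rw [Nat.card_Icc, Nat.add_sub_cancel]
  have hsplit : (nSqAddOnePrimeCount x : ℝ) - y
      ≤ (#((Icc (y + 1) x).filter fun n : ℕ => Nat.Prime (n ^ 2 + 1)) : ℝ) := by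
    have h' : (nSqAddOnePrimeCount x : ℝ)
        ≤ (y : ℝ) + (#((Icc (y + 1) x).filter fun n : ℕ => Nat.Prime (n ^ 2 + 1)) : ℝ) := by
      exact_mod_cast h
    linarith
  by_cases hcase : (y : ℝ) ≤ nSqAddOnePrimeCount x
  · have hy0 : (0 : ℝ) ≤ y := by positivity
    calc ((nSqAddOnePrimeCount x : ℝ) - y) * L
        ≤ (#((Icc (y + 1) x).filter fun n : ℕ => Nat.Prime (n ^ 2 + 1)) : ℝ)
            * (2 * Real.log ((y : ℝ) + 1)) :=
          mul_le_mul hsplit hL hL0 (by positivity)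
      _ ≤ ∑ n ∈ (Icc (y + 1) x).filter (fun n : ℕ => Nat.Prime (n ^ 2 + 1)),
            Real.log ((n ^ 2 + 1 : ℕ) : ℝ) := by
          rw [← nsmul_eq_mul]
          refine card_nsmul_le_sum _ _ _ fun n hn => ?_
          have hn1 : y + 1 ≤ n := (mem_Icc.mp (mem_filter.mp hn).1).1
          have hn' : (y : ℝ) + 1 ≤ n := by exact_mod_cast hn1
          have hn0 : (0 : ℝ) < n := by linarith
          calc 2 * Real.log ((y : ℝ) + 1) ≤ 2 * Real.log n := by
                have := Real.log_le_log (by positivity) hn'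
                linarith
            _ = Real.log ((n : ℝ) ^ 2) := by rw [Real.log_pow]; norm_num
            _ ≤ Real.log ((n ^ 2 + 1 : ℕ) : ℝ) := by
                push_cast
                exact Real.log_le_log (by positivity) (by linarith)
      _ ≤ _ := by
          refine sum_le_sum_of_subset_of_nonneg (fun n hn => ?_)
            fun n _ _ => Real.log_natCast_nonneg _
          rw [mem_filter, mem_Icc] at hn ⊢
          exact ⟨⟨by omega, hn.1.2⟩, hn.2⟩
  · push Not at hcase
    have : ((nSqAddOnePrimeCount x : ℝ) - y) * L ≤ 0 :=
      mul_nonpos_iff.mpr (Or.inr ⟨by linarith, hL0⟩)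
    linarith

/-- Scalar bookkeeping of the upper bound (`m = (S/2) X / ℓ`, cut at `X^{1-c/8}`). -/
theorem upper_of_bounds {S X ℓ c T P yv Xp : ℝ} (hS : 0 < S) (hX0 : 0 < X) (hl0 : 0 < ℓ)
    (hc : 0 < c) (hc1 : c ≤ 1) (hT2 : T ≤ S * X + c / 8 * (S * X))
    (hU : (P - yv) * (2 * ((1 - c / 8) * ℓ)) ≤ T) (hy1 : yv ≤ Xp)
    (hyx : ℓ * Xp ≤ c * S / 16 * X) : P ≤ (1 + c) * (S / 2 * X / ℓ) := by
  have hK : 0 < 2 * ((1 - c / 8) * ℓ) := by nlinarith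
  refine le_of_mul_le_mul_right ?_ hK
  have hm : S / 2 * X / ℓ * (2 * ℓ) = S * X := by field_simp
  have hpoly : 0 ≤ S * X * (5 * c / 8 - 7 * c ^ 2 / 64) :=
    mul_nonneg (mul_pos hS hX0).le (by nlinarith)
  have hyl : ℓ * yv ≤ c * S / 16 * X := (mul_le_mul_of_nonneg_left hy1 hl0.le).trans hyx
  calc P * (2 * ((1 - c / 8) * ℓ))
      = (P - yv) * (2 * ((1 - c / 8) * ℓ)) + 2 * (1 - c / 8) * (ℓ * yv) := by ring
    _ ≤ (S * X + c / 8 * (S * X)) + 2 * (1 - c / 8) * (c * S / 16 * X) :=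
        add_le_add (hU.trans hT2) (mul_le_mul_of_nonneg_left hyl (by nlinarith))
    _ ≤ (1 + c) * (1 - c / 8) * (S * X) := by linarith
    _ = (1 + c) * (S / 2 * X / ℓ) * (2 * ((1 - c / 8) * ℓ)) := by rw [← hm]; ring

/-- Scalar bookkeeping of the lower bound. -/
theorem lower_of_bounds {S X ℓ c T P L2 : ℝ} (hS : 0 < S) (hX0 : 0 < X) (hl0 : 0 < ℓ)
    (hc : 0 < c) (hcl : 1 ≤ c * ℓ) (hT1 : S * X - c / 8 * (S * X) ≤ T)
    (hTP : T ≤ P * L2) (hL2 : L2 ≤ 2 * ℓ + 1) (hP : 0 ≤ P) :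
    (1 - c) * (S / 2 * X / ℓ) ≤ P := by
  have hK : 0 < 2 * ℓ + 1 := by positivity
  refine le_of_mul_le_mul_right ?_ hK
  have hm : S / 2 * X / ℓ * (2 * ℓ) = S * X := by field_simp
  have hm0 : 0 < S / 2 * X / ℓ := by positivity
  have hmm : 1 * (S / 2 * X / ℓ) ≤ c * ℓ * (S / 2 * X / ℓ) :=
    mul_le_mul_of_nonneg_right hcl hm0.le
  have hcm : 0 < c * (S / 2 * X / ℓ) := mul_pos hc hm0
  calc (1 - c) * (S / 2 * X / ℓ) * (2 * ℓ + 1)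
      = (1 - c) * (S / 2 * X / ℓ * (2 * ℓ)) + (1 - c) * (S / 2 * X / ℓ) := by ring
    _ ≤ (1 - c / 8) * (S / 2 * X / ℓ * (2 * ℓ)) := by nlinarith
    _ = S * X - c / 8 * (S * X) := by rw [hm]; ring
    _ ≤ P * L2 := hT1.trans hTP
    _ ≤ P * (2 * ℓ + 1) := mul_le_mul_of_nonneg_left hL2 hP

/-! ### `ψ`-form ⟹ Conjecture E -/

/-- **`ψ`-form ⟹ Hardy–Littlewood E.**  If `∑_{n ≤ x} Λ(n²+1) ~ 𝔖 x` then
`#{n ≤ x : n² + 1 prime} ~ (𝔖/2) x / log x`, i.e. `HardyLittlewoodConjE`. -/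
theorem hardyLittlewoodConjE_of_isEquivalent_sum_vonMangoldt
    (hψ : (fun x : ℕ => ∑ n ∈ Icc 1 x, Λ (n ^ 2 + 1)) ~[atTop]
      fun x : ℕ => hardyLittlewoodEConst * (x : ℝ)) : HardyLittlewoodConjE := by
  rw [hardyLittlewoodConjE_iff_isEquivalent]
  have hS := hardyLittlewoodEConst_pos
  -- Step 1: `θ ~ 𝔖 x`.
  have hE : (fun x : ℕ => -∑ n ∈ (Icc 1 x).filter
      (fun n : ℕ => ¬Nat.Prime (n ^ 2 + 1) ∧ IsPrimePow (n ^ 2 + 1)), Λ (n ^ 2 + 1)) =o[atTop]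
        fun x : ℕ => hardyLittlewoodEConst * (x : ℝ) := by
    rw [isLittleO_iff]
    intro c hc
    filter_upwards [eventually_properPrimePow_sum_le (mul_pos hc hS)] with x hx
    rw [norm_neg, Real.norm_eq_abs, Real.norm_eq_abs,
      abs_of_nonneg (properPrimePow_sum_nonneg x), abs_of_nonneg (by positivity)]
    linarith
  have heq : (fun x : ℕ => ∑ n ∈ (Icc 1 x).filter (fun n : ℕ => Nat.Prime (n ^ 2 + 1)),
      Real.log ((n ^ 2 + 1 : ℕ) : ℝ))
      = (fun x : ℕ => ∑ n ∈ Icc 1 x, Λ (n ^ 2 + 1))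
        + fun x : ℕ => -∑ n ∈ (Icc 1 x).filter
          (fun n : ℕ => ¬Nat.Prime (n ^ 2 + 1) ∧ IsPrimePow (n ^ 2 + 1)), Λ (n ^ 2 + 1) := by
    funext x
    simp only [Pi.add_apply]
    rw [sum_vonMangoldt_eq_theta_add]
    ring
  have hθ : (fun x : ℕ => ∑ n ∈ (Icc 1 x).filter (fun n : ℕ => Nat.Prime (n ^ 2 + 1)),
      Real.log ((n ^ 2 + 1 : ℕ) : ℝ)) ~[atTop]
        fun x : ℕ => hardyLittlewoodEConst * (x : ℝ) := by
    rw [heq]; exact hψ.add_isLittleO hE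
  -- Step 2: the sandwich, for `0 < c ≤ 1`.
  have key : ∀ c : ℝ, 0 < c → c ≤ 1 → ∀ᶠ x : ℕ in atTop,
      |(nSqAddOnePrimeCount x : ℝ) - hardyLittlewoodEConst / 2 * x / Real.log x|
        ≤ c * (hardyLittlewoodEConst / 2 * x / Real.log x) := by
    intro c hc hc1
    have e1 := hθ.isLittleO.bound (show (0 : ℝ) < c / 8 by positivity)
    have e2 : ∀ᶠ t : ℝ in atTop,
        ‖Real.log t‖ ≤ c * hardyLittlewoodEConst / 16 * ‖t ^ (c / 8)‖ :=
      (isLittleO_log_rpow_atTop (by positivity : 0 < c / 8)).bound (by positivity)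
    have hlogT : Tendsto (fun x : ℕ => Real.log (x : ℝ)) atTop atTop :=
      Real.tendsto_log_atTop.comp tendsto_natCast_atTop_atTop
    filter_upwards [e1, tendsto_natCast_atTop_atTop.eventually e2,
      hlogT.eventually_ge_atTop (1 / c), eventually_ge_atTop 3] with x hx1 hx2 hx3 hx4
    have hX : (3 : ℝ) ≤ x := by exact_mod_cast hx4
    have hX0 : (0 : ℝ) < x := by linarith
    have hl0 : 0 < Real.log (x : ℝ) := Real.log_pos (by linarith)
    have hcl : 1 ≤ c * Real.log (x : ℝ) := by
      have := (div_le_iff₀' hc).mp hx3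
      linarith
    -- `|θ - 𝔖 x| ≤ (c/8) 𝔖 x`
    have hx1' : |∑ n ∈ (Icc 1 x).filter (fun n : ℕ => Nat.Prime (n ^ 2 + 1)),
        Real.log ((n ^ 2 + 1 : ℕ) : ℝ) - hardyLittlewoodEConst * x|
          ≤ c / 8 * (hardyLittlewoodEConst * x) := by
      simpa only [Pi.sub_apply, Real.norm_eq_abs, abs_of_pos (mul_pos hS hX0)] using hx1
    obtain ⟨hT2, hT1⟩ := abs_sub_le_iff.mp hx1'
    -- the cut point `y = ⌊x^{1 - c/8}⌋`
    have hy1 : (⌊(x : ℝ) ^ (1 - c / 8)⌋₊ : ℝ) ≤ (x : ℝ) ^ (1 - c / 8) :=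
      Nat.floor_le (by positivity)
    have hy2 : (x : ℝ) ^ (1 - c / 8) ≤ (⌊(x : ℝ) ^ (1 - c / 8)⌋₊ : ℝ) + 1 :=
      (Nat.lt_floor_add_one _).le
    have hL : 2 * ((1 - c / 8) * Real.log x)
        ≤ 2 * Real.log ((⌊(x : ℝ) ^ (1 - c / 8)⌋₊ : ℝ) + 1) := by
      rw [← Real.log_rpow hX0]
      have := Real.log_le_log (by positivity) hy2
      linarith
    have hU := card_sub_mul_le_theta x ⌊(x : ℝ) ^ (1 - c / 8)⌋₊
      (by nlinarith : 0 ≤ 2 * ((1 - c / 8) * Real.log x)) hL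
    -- `log x · x^{1-c/8} ≤ (c 𝔖/16) x`
    rw [Real.norm_eq_abs, Real.norm_eq_abs, abs_of_pos hl0,
      abs_of_pos (by positivity)] at hx2
    have hyx : Real.log x * (x : ℝ) ^ (1 - c / 8) ≤ c * hardyLittlewoodEConst / 16 * x := by
      have h := mul_le_mul_of_nonneg_right hx2
        (by positivity : (0 : ℝ) ≤ (x : ℝ) ^ (1 - c / 8))
      rw [mul_assoc, ← Real.rpow_add hX0, show c / 8 + (1 - c / 8) = (1 : ℝ) by ring,
        Real.rpow_one] at h
      exact h
    have hlog2x : Real.log ((x : ℝ) ^ 2 + 1) ≤ 2 * Real.log x + 1 := by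
      have h2 : (x : ℝ) ^ 2 + 1 ≤ 2 * (x : ℝ) ^ 2 := by nlinarith
      calc Real.log ((x : ℝ) ^ 2 + 1) ≤ Real.log (2 * (x : ℝ) ^ 2) :=
            Real.log_le_log (by positivity) h2
        _ = Real.log 2 + 2 * Real.log x := by
            rw [Real.log_mul (by norm_num) (by positivity), Real.log_pow]; norm_num
        _ ≤ 2 * Real.log x + 1 := by linarith [Real.log_two_lt_d9]
    have hup := upper_of_bounds hS hX0 hl0 hc hc1 (by linarith) hU hy1 hyx
    have hlow := lower_of_bounds hS hX0 hl0 hc hcl (by linarith)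
      (theta_le_card_mul_log x) hlog2x (by positivity)
    rw [abs_sub_le_iff]
    exact ⟨by linarith only [hup], by linarith only [hlow]⟩
  -- Step 3: conclude.
  show (fun x : ℕ => (nSqAddOnePrimeCount x : ℝ) - hardyLittlewoodEConst / 2 * x / Real.log x)
    =o[atTop] fun x : ℕ => hardyLittlewoodEConst / 2 * x / Real.log x
  rw [isLittleO_iff]
  intro c hc
  filter_upwards [key (min c 1) (lt_min hc one_pos) (min_le_right _ _),
    eventually_ge_atTop 3] with x hx hx3
  have hX : (3 : ℝ) ≤ x := by exact_mod_cast hx3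
  have hm0 : 0 < hardyLittlewoodEConst / 2 * x / Real.log x := by
    have := Real.log_pos (by linarith : (1 : ℝ) < x); positivity
  rw [Real.norm_eq_abs, Real.norm_eq_abs, abs_of_pos hm0]
  exact hx.trans (mul_le_mul_of_nonneg_right (min_le_left _ _) hm0.le)

/-- **The complete kernel path.**  `(R1) → (R2)_ε → (R3)_ε → HardyLittlewoodConjE`
(hypotheses exactly as in `isEquivalent_sum_vonMangoldt_of_threeRanges`). -/
theorem hardyLittlewoodConjE_of_threeRanges {ε : ℝ} (hε : 0 < ε)
    (R1 : Tendsto (fun D : ℕ => -∑ d ∈ Icc 1 D, (μ d : ℝ) * Real.log d * rho d / d) atTop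
      (𝓝 hardyLittlewoodEConst))
    (R2 : ∀ δ : ℝ, 0 < δ → ∀ᶠ x : ℕ in atTop,
      |∑ d ∈ (Icc 1 ⌊(x : ℝ) ^ (1 + ε)⌋₊).filter
          (fun d : ℕ => (x : ℝ) ^ (1 - ε) < d), (μ d : ℝ) * Real.log d * rem (x : ℝ) d|
        ≤ δ * x)
    (R3 : ∀ δ : ℝ, 0 < δ → ∀ᶠ x : ℕ in atTop,
      ∑ e ∈ Icc 1 (⌊2 * (x : ℝ) ^ (1 - ε)⌋₊ + 1),
          (range (x + 1)).sup' nonempty_range_add_one (fun y =>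
            |∑ n ∈ (Icc 1 y).filter (fun n => e ∣ n ^ 2 + 1), (μ ((n ^ 2 + 1) / e) : ℝ)|)
        ≤ δ * x / Real.log x) :
    HardyLittlewoodConjE :=
  hardyLittlewoodConjE_of_isEquivalent_sum_vonMangoldt
    (isEquivalent_sum_vonMangoldt_of_threeRanges hε R1 R2 R3)

end Summit.Parity.BatemanHorn.Theorems
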